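import Summits.HodgeConjecture.HodgeConjecture.Theorems.HeckePrymWeilWeilTwelvefoldsSqrtMinus7IsotypicHeckePrymPlaneCoinvariants
import Summits.HodgeConjecture.HodgeConjecture.Theorems.HeckePrymWeilWeilTwelvefoldsSqrtMinus7IsotypicHeckePrymPlaneTyping
import Literature.AlgebraicGeometry.HodgeTheory.AbelianVarietyPullbackAlgebraicClasses
import Literature.AlgebraicGeometry.Motives.Jacobian
import HarnessLib

/-!
# The Hecke–Prym's typed Weil plane is ONE restriction of Schoen's lines (stub `stub_heckePrymWeilPlane`, conjuncts 2–3)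

Helper file for line `isotypic-unimodular-saturation` of crux `HeckePrymWeil.WeilTwelvefoldsSqrtMinus7`
(`--supports stmt-HodgeConjecture-1261`).  It proves, UNCONDITIONALLY and sorry-free, the second and
third conjuncts of the registered stub `stub_heckePrymWeilPlane` in its exact binder shape
(`heckePrymWeilPlane_sq_and_algebraic`):

for the `F₂₁ = ⟨σ⟩ ⋊ ⟨τ⟩`-datum (`s = σ_*`, `t = τ_*` on a Jacobian `𝒥`, `e_N = Σ_{i<7} sⁱ`,
`B = (ker e_N)⁰` with restrictions `s_B`, `t_B`, the Hecke–Prym `P' = (ker(𝟙_B - t_B))⁰` with inclusion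
`j`, and `φ'` restricting `η_B = s_B + s_B² + s_B⁴ - s_B³ - s_B⁵ - s_B⁶`), IF the six Schoen lines
`Eig((2·𝟙_B + s_B)^*|H¹², (2 + ζ₇^a)¹²)`, `1 ≤ a ≤ 6`, consist of algebraic classes, THEN
`φ' ≫ φ' = -7` and every class of the typed Weil plane
`Eig((𝟙+φ')^*|H¹², (1+i√7)¹²) ⊔ Eig((𝟙+φ')^*|H¹², (1-i√7)¹²)` of `P'` is algebraic.

The lever (`heckePrym_typedWeilPlane_le_algebraicClasses`, on abstract carriers `B`, `P`):
`Eig((𝟙+φ')^*, (1±i√7)¹²)` is spanned by cup products `v₀ ⌣ ⋯ ⌣ v₁₁` of classes of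
`V_± = Eig(φ'^*|H¹(P'), ±i√7)` (`…Typing.eigenspace_map_id_add_le_span_cupPowOne` with
`Negative.EigenvalueTyping.mixed_eq_plus_iff` / `…_minus_iff`); each `vᵢ = j^* wᵢ` with all `wᵢ` in ONE
isotypic piece `H¹(B)_{ζ^a}` (`…Coinvariants.exists_isotypic_preimage`: `j^*` is the `μ₃`-coinvariant
map, `a = 1` or `3`); so `v₀ ⌣ ⋯ ⌣ v₁₁ = j^*(w₀ ⌣ ⋯ ⌣ w₁₁)` (naturality) with `w₀ ⌣ ⋯ ⌣ w₁₁` in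
Schoen's line `Eig((2·𝟙_B+s_B)^*, (2+ζ^a)¹²)` (`…Typing.cupPowOne_mem_eigenspace_two_smul_id_add`),
hence algebraic by hypothesis, and `j^*` preserves algebraic classes
(`HodgeTheory.AbelianVariety.map_mem_algebraicClasses_of_abelianVariety`, Kleiman/Fulton, PROVED in
the tree).  No use is made of the curve, of fixed-point freeness, of `dim 𝒥 = 43`, or of any
dimension: the FIRST conjunct `dim P' = 12` (Chevalley–Weil for the étale cover; Lefschetz fixed-point
formula + `H¹(J) ≅ H¹(C)`, absent from the tree) is NOT proved here.
-/

noncomputable section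

set_option linter.dupNamespace false

open CategoryTheory
open Literature.AlgebraicGeometry Literature.AlgebraicGeometry.Motives
  Literature.AlgebraicGeometry.HodgeTheory Literature.AlgebraicTopology.SingularHomology

namespace Summit.HodgeConjecture.HodgeConjecture.Theorems.WeilTwelvefoldsSqrtMinus7.IsotypicUnimodularSaturation

/-- Eigenvalue separation at `μ = i√7`, degree `12`: `(1+i√7)ᵃ(1-i√7)ᵇ ≠ (1+i√7)¹²` for `a + b = 12`,
`b ≥ 1` (`Negative.EigenvalueTyping.mixed_eq_plus_iff`). [folklore] -/
theorem separation_plus (a b : ℕ) (hab : a + b = 12) (hb : 0 < b) :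
    (1 + Complex.I * (Real.sqrt (7 : ℝ) : ℂ)) ^ a * (1 - Complex.I * (Real.sqrt (7 : ℝ) : ℂ)) ^ b ≠
      (1 + Complex.I * (Real.sqrt (7 : ℝ) : ℂ)) ^ 12 := by
  rw [← hab]
  exact fun h => hb.ne' ((Negative.mixed_eq_plus_iff a b).1 h)

/-- Eigenvalue separation at `μ = -i√7`, degree `12` (`Negative.EigenvalueTyping.mixed_eq_minus_iff`).
[folklore] -/
theorem separation_minus (a b : ℕ) (hab : a + b = 12) (hb : 0 < b) :
    (1 + -(Complex.I * (Real.sqrt (7 : ℝ) : ℂ))) ^ a * (1 - -(Complex.I * (Real.sqrt (7 : ℝ) : ℂ))) ^ b ≠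
      (1 + -(Complex.I * (Real.sqrt (7 : ℝ) : ℂ))) ^ 12 := by
  rw [← sub_eq_add_neg, sub_neg_eq_add, mul_comm, ← hab, Nat.add_comm a b]
  exact fun h => hb.ne' ((Negative.mixed_eq_minus_iff b a).1 h)

/-- **The lever, on abstract carriers.**  Let `B`, `P` be complex abelian varieties with
`s_B, t_B ∈ End B`, `Φ₇(s_B) = 0`, `s_B t_B = t_B s_B²`, `t_B³ = 𝟙`, a monomorphism `j : P ↪ B` with
`j ≫ t_B = j` and a section `q` (`q ≫ j = 𝟙 + t_B + t_B²`), and `φ' ∈ End P` with `φ' ≫ j = j ≫ η_B`.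
If the six Schoen lines `Eig((2·𝟙_B + s_B)^*|H¹²(B), (2 + ζ₇^a)¹²)`, `1 ≤ a ≤ 6`, consist of algebraic
classes, then so does the typed Weil plane `Eig((𝟙+φ')^*|H¹²(P), (1+i√7)¹²) ⊔ Eig(…, (1-i√7)¹²)`.
[folklore] -/
theorem heckePrym_typedWeilPlane_le_algebraicClasses {B P : AbelianVariety ℂ} {sB tB : B ⟶ B}
    {j : P ⟶ B} [Mono j] {q : B ⟶ P} {φ' : P ⟶ P}
    (h : 𝟙 B + sB + sB ≫ sB + sB ≫ sB ≫ sB + sB ≫ sB ≫ sB ≫ sB + sB ≫ sB ≫ sB ≫ sB ≫ sB +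
      sB ≫ sB ≫ sB ≫ sB ≫ sB ≫ sB = 0)
    (hst : sB ≫ tB = tB ≫ sB ≫ sB) (hj : j ≫ tB = j) (h3 : tB ≫ tB ≫ tB = 𝟙 B)
    (hq : q ≫ j = 𝟙 B + tB + tB ≫ tB)
    (hφ' : φ' ≫ j = j ≫ (sB + sB ≫ sB + sB ≫ sB ≫ sB ≫ sB - sB ≫ sB ≫ sB -
      sB ≫ sB ≫ sB ≫ sB ≫ sB - sB ≫ sB ≫ sB ≫ sB ≫ sB ≫ sB))
    (hS : ∀ a : ℕ, 1 ≤ a → a ≤ 6 → ∀ c : complexBetti B.X 12,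
      c ∈ Module.End.eigenspace (complexBetti.map ((2 : ℤ) • 𝟙 B + sB).hom.hom.hom 12).hom
          ((2 + Complex.exp (2 * (Real.pi : ℂ) * Complex.I / 7) ^ a) ^ 12) →
        c ∈ algebraicClasses B.X 6)
    (c : complexBetti P.X 12)
    (hc : c ∈ Module.End.eigenspace (complexBetti.map (𝟙 P + φ').hom.hom.hom 12).hom
          ((1 + Complex.I * (Real.sqrt (7 : ℝ) : ℂ)) ^ 12) ⊔
        Module.End.eigenspace (complexBetti.map (𝟙 P + φ').hom.hom.hom 12).hom
          ((1 - Complex.I * (Real.sqrt (7 : ℝ) : ℂ)) ^ 12)) :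
    c ∈ algebraicClasses P.X 6 := by
  -- `φ' ≫ φ' = -7`
  have hφ'7 : φ' ≫ φ' = -((7 : ℕ) • 𝟙 P) := by
    rw [restrict_heckeElement_comp_self h rfl hφ', ofNat_zsmul]
  -- each typed eigenspace is spanned by pure wedges of `V_±`, which are pulled-back Schoen classes
  have key : ∀ μ : ℂ, (μ = Complex.I * (Real.sqrt (7 : ℝ) : ℂ) ∨ μ = -(Complex.I * (Real.sqrt (7 : ℝ) : ℂ))) →
      (∀ a b : ℕ, a + b = 12 → 0 < b → (1 + μ) ^ a * (1 - μ) ^ b ≠ (1 + μ) ^ 12) →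
      Module.End.eigenspace (complexBetti.map (𝟙 P + φ').hom.hom.hom 12).hom ((1 + μ) ^ 12) ≤
        algebraicClasses P.X 6 := by
    intro μ hμ hsep
    have hμ' : μ = Complex.I * (Real.sqrt (7 : ℕ) : ℂ) ∨ μ = -(Complex.I * (Real.sqrt (7 : ℕ) : ℂ)) := by
      simpa only [Nat.cast_ofNat] using hμ
    refine le_trans (eigenspace_map_id_add_le_span_cupPowOne (by norm_num : 0 < 7) hφ'7 hμ' 12 hsep) ?_
    rw [Submodule.span_le]
    rintro _ ⟨v, hv, rfl⟩
    obtain ⟨a, ha1, ha6, hpre⟩ := exists_isotypic_preimage h hst hj h3 hq hφ' hμ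
    choose w hw hjw using fun i => hpre (v i) (hv i)
    have e : cupPowOne ℂ (ComplexPoints P.X) 12 v =
        complexBetti.map j.hom.hom.hom 12 (cupPowOne ℂ (ComplexPoints B.X) 12 w) := by
      rw [complexBetti_map_cupPowOne_hom]
      congr 1
      funext i
      exact (hjw i).symm
    rw [SetLike.mem_coe, e]
    exact map_mem_algebraicClasses_of_abelianVariety (p := 6) AbelianVariety.isSmoothProjective_holds B
      j.hom.hom.hom (hS a ha1 ha6 _ (cupPowOne_mem_eigenspace_two_smul_id_add sB 12 w hw))
  have hp := key _ (Or.inl rfl) separation_plus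
  have hm := key _ (Or.inr rfl) separation_minus
  rw [← sub_eq_add_neg] at hm
  exact sup_le hp hm hc

/-- **Conjuncts 2 and 3 of `stub_heckePrymWeilPlane`, in its exact binder shape** (line
`isotypic-unimodular-saturation`, crux `HeckePrymWeil.WeilTwelvefoldsSqrtMinus7`): for the
`F₂₁`-datum of the stub and GIVEN the six Schoen lines of `(B, s_B)` are algebraic,
`φ' ≫ φ' = -7` and the typed Weil plane of the Hecke–Prym `(P', φ')` consists of algebraic classes.
The relations on `B` come from the curve (`σ τ = τ σ²`, `τ³ = 𝟙`: `pushforward_rel`,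
`pushforward_comp_pow_three`, `kerComponent_restrict_rel`, `kerComponent_restrict_comp_pow_three`;
`Φ₇(s_B) = 0`: `kerComponent_cyclotomic₇_restrict_eq_zero`), the section `q` from
`heckePrym_exists_section`, and the lever is `heckePrym_typedWeilPlane_le_algebraicClasses`.  The
hypotheses on smoothness, `dim 𝒥 = 43`, `σ⁷ = 𝟙` and fixed-point freeness are not used (they matter
only for the first conjunct `dim P' = 12`, not proved here). [folklore] -/
theorem heckePrymWeilPlane_sq_and_algebraic :
    ∀ (C : SchemeOver ℂ) (𝒥 : Jacobian C) (σ τ : C ⟶ C),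
      IsSmoothProjective 1 C → 𝒥.J.dim = 43 →
      σ ≫ σ ≫ σ ≫ σ ≫ σ ≫ σ ≫ σ = 𝟙 C → τ ≫ τ ≫ τ = 𝟙 C → σ ≫ τ = τ ≫ σ ≫ σ →
      (∀ P : ComplexPoints C, P ≫ σ ≠ P ∧ P ≫ τ ≠ P) →
    ∀ (s t eN : 𝒥.J ⟶ 𝒥.J), s = 𝒥.pushforward 𝒥 σ → t = 𝒥.pushforward 𝒥 τ →
      eN = 𝟙 𝒥.J + s + s ≫ s + s ≫ s ≫ s + s ≫ s ≫ s ≫ s + s ≫ s ≫ s ≫ s ≫ s +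
        s ≫ s ≫ s ≫ s ≫ s ≫ s →
    ∀ (sB tB : AbelianVariety.kerComponent eN ⟶ AbelianVariety.kerComponent eN),
      sB ≫ AbelianVariety.kerComponentι eN = AbelianVariety.kerComponentι eN ≫ s →
      tB ≫ AbelianVariety.kerComponentι eN = AbelianVariety.kerComponentι eN ≫ t →
    ∀ (φ' : AbelianVariety.kerComponent (𝟙 (AbelianVariety.kerComponent eN) - tB) ⟶
        AbelianVariety.kerComponent (𝟙 (AbelianVariety.kerComponent eN) - tB)),
      φ' ≫ AbelianVariety.kerComponentι (𝟙 (AbelianVariety.kerComponent eN) - tB) =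
        AbelianVariety.kerComponentι (𝟙 (AbelianVariety.kerComponent eN) - tB) ≫
          (sB + sB ≫ sB + sB ≫ sB ≫ sB ≫ sB - sB ≫ sB ≫ sB - sB ≫ sB ≫ sB ≫ sB ≫ sB -
            sB ≫ sB ≫ sB ≫ sB ≫ sB ≫ sB) →
    (∀ a : ℕ, 1 ≤ a → a ≤ 6 →
      ∀ c : complexBetti (AbelianVariety.kerComponent eN).X 12,
        c ∈ Module.End.eigenspace
            (complexBetti.map ((2 : ℤ) • 𝟙 (AbelianVariety.kerComponent eN) + sB).hom.hom.hom 12).hom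
            ((2 + Complex.exp (2 * (Real.pi : ℂ) * Complex.I / 7) ^ a) ^ 12) →
        c ∈ algebraicClasses (AbelianVariety.kerComponent eN).X 6) →
    φ' ≫ φ' = -((7 : ℤ) • 𝟙 (AbelianVariety.kerComponent (𝟙 (AbelianVariety.kerComponent eN) - tB))) ∧
    ∀ c : complexBetti (AbelianVariety.kerComponent (𝟙 (AbelianVariety.kerComponent eN) - tB)).X 12,
      c ∈ Module.End.eigenspace (complexBetti.map
              (𝟙 (AbelianVariety.kerComponent (𝟙 (AbelianVariety.kerComponent eN) - tB)) + φ').hom.hom.hom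
              12).hom ((1 + Complex.I * (Real.sqrt (7 : ℝ) : ℂ)) ^ 12) ⊔
          Module.End.eigenspace (complexBetti.map
              (𝟙 (AbelianVariety.kerComponent (𝟙 (AbelianVariety.kerComponent eN) - tB)) + φ').hom.hom.hom
              12).hom ((1 - Complex.I * (Real.sqrt (7 : ℝ) : ℂ)) ^ 12) →
      c ∈ algebraicClasses (AbelianVariety.kerComponent (𝟙 (AbelianVariety.kerComponent eN) - tB)).X 6 := by
  intro C 𝒥 σ τ _hC _hg _hσ7 hτ3 hrel _hfree s t eN hs ht heN sB tB hsB htB φ' hφ' hS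
  have h := kerComponent_cyclotomic₇_restrict_eq_zero heN hsB
  have hst := kerComponent_restrict_rel hsB htB (pushforward_rel 𝒥 hrel hs ht)
  have h3 := kerComponent_restrict_comp_pow_three htB (pushforward_comp_pow_three 𝒥 hτ3 ht)
  obtain ⟨q, hq⟩ := heckePrym_exists_section h3
  exact ⟨restrict_heckeElement_comp_self h rfl hφ',
    heckePrym_typedWeilPlane_le_algebraicClasses h hst heckePrym_incl_comp h3 hq hφ' hS⟩

end Summit.HodgeConjecture.HodgeConjecture.Theorems.WeilTwelvefoldsSqrtMinus7.IsotypicUnimodularSaturation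

end
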